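import Literature.Computability.AlgebraicComplexity.MS21ANFFirstDerivativeHitting
import HarnessLib

/-!
# Medini–Shpilka 2021, Lemma 5.12 support calculus: monomials of `ANF_{Δ+1}` blockwise

Topic `Literature/Computability/AlgebraicComplexity` (cell `val-lit`, row X6-MS21; stage 5.12b of the
Lemma 5.12 (`lem:roanfMonInc`) brick for the discharge of `MS2021_thm_35`; one writer, theorem-only,
no definitions, no named facts). Source: D. Medini, A. Shpilka, arXiv:2102.05632 [MediniShpilka2021],
proof of Lemma 5.12 (p0027:L44–p0028:L40): the induction on `Δ` manipulates MONOMIAL SETS of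
`ANF_{Δ+1} = F₁F₂ + F₃F₄` ("`mon(g₁g₂) ⊆ mon(F₁F₂)`", "every monomial of `∂g/∂x_i` is divisible by the
sibling `x_j`", "restriction of monomials to `var(F_i)`"). This file supplies that bookkeeping in the
tree's vocabulary (`anf`, `anfBlock`, x5's `anf_succ_eq_block` / `exists_sibling_decomposition`):

* products of variable-disjoint polynomials: exponents add UNIQUELY
  (`add_eq_add_iff_of_support_subset_disjoint`), `coeff (m₁+m₂) (pq) = coeff m₁ p · coeff m₂ q`
  (`coeff_add_mul_of_disjoint_vars`), and `mon(pq) = mon(p) + mon(q)`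
  (`mem_support_mul_iff_of_disjoint_vars`);
* `vars (ANF_Δ) = all`, `vars (A_b) = block b`, blocks pairwise variable-disjoint, `coeff 0 ANF = 0`;
* `mon(ANF_{Δ+1}) = mon(A_b A_{1-b}) ⊔ mon(A_{b+2} A_{1-(b+2)})` (`support_anf_succ`,
  `disjoint_support_blockProd`), monomials of a block product = sums of renamed block monomials
  (`mem_support_rename_anfBlock_mul_iff`);
* siblings: every monomial of `ANF_{Δ+1}` containing `x_i` contains its sibling and conversely
  (`exists_sibling_mem_support`), so the monomials of `∂_i ANF` are divisible by the sibling;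
* block permutations (the `TR` "WLOG"s): `exists_perm_anfBlock`, `rename_anf_succ_eq_of_blockPerm`
  (pairing-preserving block permutation × inner symmetries fixes `ANF_{Δ+1}`),
  `aeval_C_mul_X_perm_rename_anfBlock` (blockwise assembly of `α, π`).

HONEST FRAMING: elementary support lemmas for a 2021 published proof; `VP ≠ VNP` is NOT proved and
nothing here bears on it.

## References

* [MediniShpilka2021] D. Medini, A. Shpilka, arXiv:2102.05632, Lemma 5.12 and its proof
  (p0027:L40-p0028:L40), Def 8 (blocks), Obs 5.7-5.8 (siblings).
-/

noncomputable section

open MvPolynomial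

namespace Literature.Computability.AlgebraicComplexity

namespace MS2021

/-! ### Products of variable-disjoint polynomials -/

section Disjoint

variable {K : Type*} [Field K] {σ : Type*}

/-- The exponent of a monomial of `p` is supported on `vars p`. [folklore] -/
private theorem support_subset_vars_of_mem_support {p : MvPolynomial σ K} {m : σ →₀ ℕ}
    (hm : m ∈ p.support) : m.support ⊆ p.vars :=
  fun x hx => (mem_vars_iff_mem_support x).mpr ⟨m, hm, hx⟩

/-- **Exponents on disjoint variable sets add uniquely**: if `m₁, n₁` live on `V₁` and `m₂, n₂` on `V₂`,
`V₁ ∩ V₂ = ∅`, then `m₁ + m₂ = n₁ + n₂ ↔ m₁ = n₁ ∧ m₂ = n₂` ("restriction of monomials to `var(F_i)`").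
[cite: MediniShpilka2021, proof of Lemma 5.12 (arXiv p0028:L34-L36, the displayed restriction identity)] -/
theorem add_eq_add_iff_of_support_subset_disjoint [DecidableEq σ] {V₁ V₂ : Finset σ}
    (hV : Disjoint V₁ V₂) {m₁ m₂ n₁ n₂ : σ →₀ ℕ} (h₁ : m₁.support ⊆ V₁) (h₂ : m₂.support ⊆ V₂)
    (h₁' : n₁.support ⊆ V₁) (h₂' : n₂.support ⊆ V₂) :
    m₁ + m₂ = n₁ + n₂ ↔ m₁ = n₁ ∧ m₂ = n₂ := by
  refine ⟨fun h => ?_, fun h => by rw [h.1, h.2]⟩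
  have key : ∀ x, m₁ x = n₁ x := by
    intro x
    have hx := congrArg (fun f => f x) h
    simp only [Finsupp.add_apply] at hx
    by_cases hx1 : x ∈ V₁
    · have hx2 : x ∉ V₂ := Finset.disjoint_left.mp hV hx1
      have a : m₂ x = 0 := Finsupp.notMem_support_iff.mp fun hh => hx2 (h₂ hh)
      have b : n₂ x = 0 := Finsupp.notMem_support_iff.mp fun hh => hx2 (h₂' hh)
      omega
    · have a : m₁ x = 0 := Finsupp.notMem_support_iff.mp fun hh => hx1 (h₁ hh)
      have b : n₁ x = 0 := Finsupp.notMem_support_iff.mp fun hh => hx1 (h₁' hh)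
      omega
  have e1 : m₁ = n₁ := Finsupp.ext key
  refine ⟨e1, ?_⟩
  rw [e1] at h
  exact add_left_cancel h

/-- **Coefficients of a product of variable-disjoint polynomials**:
`coeff (m₁ + m₂) (p q) = coeff m₁ p · coeff m₂ q` for monomials `m₁` of `p`, `m₂` of `q`.
[cite: MediniShpilka2021, proof of Lemma 5.12 (monomials of `F₁F₂`, `g₁g₂`; arXiv p0028:L10-L36)] -/
theorem coeff_add_mul_of_disjoint_vars [DecidableEq σ] {p q : MvPolynomial σ K}
    (hd : Disjoint p.vars q.vars) {m₁ m₂ : σ →₀ ℕ} (h₁ : m₁ ∈ p.support) (h₂ : m₂ ∈ q.support) :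
    coeff (m₁ + m₂) (p * q) = coeff m₁ p * coeff m₂ q := by
  rw [coeff_mul]
  refine Finset.sum_eq_single_of_mem (m₁, m₂) (Finset.HasAntidiagonal.mem_antidiagonal.mpr rfl)
    fun x hx hne => ?_
  by_contra hprod
  have hx1 : x.1 ∈ p.support := mem_support_iff.mpr (left_ne_zero_of_mul hprod)
  have hx2 : x.2 ∈ q.support := mem_support_iff.mpr (right_ne_zero_of_mul hprod)
  have hsum : x.1 + x.2 = m₁ + m₂ := Finset.HasAntidiagonal.mem_antidiagonal.mp hx
  obtain ⟨e1, e2⟩ := (add_eq_add_iff_of_support_subset_disjoint hd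
    (support_subset_vars_of_mem_support hx1) (support_subset_vars_of_mem_support hx2)
    (support_subset_vars_of_mem_support h₁) (support_subset_vars_of_mem_support h₂)).mp hsum
  exact hne (Prod.ext e1 e2)

/-- **Monomials of a product of variable-disjoint polynomials** are exactly the sums of a monomial of
each factor. [cite: MediniShpilka2021, proof of Lemma 5.12 (arXiv p0028:L10-L36)] -/
theorem mem_support_mul_iff_of_disjoint_vars [DecidableEq σ] {p q : MvPolynomial σ K}
    (hd : Disjoint p.vars q.vars) {m : σ →₀ ℕ} :
    m ∈ (p * q).support ↔ ∃ m₁ ∈ p.support, ∃ m₂ ∈ q.support, m = m₁ + m₂ := by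
  constructor
  · intro hm
    obtain ⟨m₁, h₁, m₂, h₂, h⟩ := Finset.mem_add.mp (support_mul p q hm)
    exact ⟨m₁, h₁, m₂, h₂, h.symm⟩
  · rintro ⟨m₁, h₁, m₂, h₂, rfl⟩
    rw [mem_support_iff, coeff_add_mul_of_disjoint_vars hd h₁ h₂]
    exact mul_ne_zero (mem_support_iff.mp h₁) (mem_support_iff.mp h₂)

/-- Supports of variable-disjoint polynomials without constant term are disjoint. [folklore] -/
private theorem disjoint_support_of_disjoint_vars [DecidableEq σ] {p q : MvPolynomial σ K}
    (hd : Disjoint p.vars q.vars) (hp : coeff 0 p = 0) : Disjoint p.support q.support := by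
  rw [Finset.disjoint_left]
  intro m hmp hmq
  have h1 := support_subset_vars_of_mem_support hmp
  have h2 := support_subset_vars_of_mem_support hmq
  have hm0 : m = 0 := by
    ext x
    by_contra hx
    have hx' : x ∈ m.support := Finsupp.mem_support_iff.mpr hx
    exact Finset.disjoint_left.mp hd (h1 hx') (h2 hx')
  rw [hm0] at hmp
  exact (mem_support_iff.mp hmp) hp

end Disjoint

/-! ### Variables and constant terms of `ANF_Δ` and of its blocks -/

section Vars

variable {K : Type*} [Field K]

/-- `ANF_Δ` involves every variable. [cite: MediniShpilka2021, Def 8 (arXiv p0025:L31-L37)] -/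
theorem vars_anf (Δ : ℕ) : (anf K Δ).vars = Finset.univ := by
  classical
  refine Finset.eq_univ_of_forall fun x => ?_
  by_contra hx
  exact pderiv_anf_ne_zero K Δ x (pderiv_eq_zero_of_notMem_vars hx)

/-- The block `A_b = ANF_Δ(x^{(b)})` involves exactly the variables of block `b`.
[cite: MediniShpilka2021, Def 8 (arXiv p0025:L31-L37)] -/
theorem vars_rename_anfBlock_anf (Δ : ℕ) (b : Fin 4) :
    (rename (anfBlock Δ b) (anf K Δ)).vars = Finset.univ.image (anfBlock Δ b) := by
  classical
  refine Finset.Subset.antisymm ((vars_rename _ _).trans (Finset.image_subset_image (Finset.subset_univ _))) ?_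
  intro x hx
  obtain ⟨j, -, rfl⟩ := Finset.mem_image.mp hx
  by_contra hx'
  have h0 := pderiv_eq_zero_of_notMem_vars hx'
  rw [pderiv_anfBlock_rename_self] at h0
  exact pderiv_anf_ne_zero K Δ j (rename_injective _ (anfBlock_injective Δ b) (by rw [h0, map_zero]))

/-- Polynomials renamed into different blocks are variable-disjoint. [cite: MediniShpilka2021, Def 8] -/
theorem disjoint_vars_rename_anfBlock (Δ : ℕ) {b b' : Fin 4} (hb : b ≠ b')
    (p q : MvPolynomial (Fin (4 ^ Δ)) K) :
    Disjoint (rename (anfBlock Δ b) p).vars (rename (anfBlock Δ b') q).vars := by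
  classical
  refine Finset.disjoint_of_subset_left (vars_rename _ _)
    (Finset.disjoint_of_subset_right (vars_rename _ _) ?_)
  rw [Finset.disjoint_left]
  intro x hx hx'
  obtain ⟨y, -, rfl⟩ := Finset.mem_image.mp hx
  obtain ⟨y', -, h⟩ := Finset.mem_image.mp hx'
  exact hb (anfBlock_inj h).1.symm

/-- `ANF_Δ` has no constant term. [cite: MediniShpilka2021, Def 8 (`ANF_Δ` is `2^Δ`-homogeneous)] -/
theorem coeff_zero_anf (Δ : ℕ) : coeff 0 (anf K Δ) = 0 :=
  (isHomogeneous_anf K Δ).coeff_eq_zero (by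
    rw [map_zero]
    exact (pow_pos (by norm_num : (0 : ℕ) < 2) Δ).ne)

/-- A renamed block has no constant term. [cite: MediniShpilka2021, Def 8] -/
theorem coeff_zero_rename_anfBlock_anf (Δ : ℕ) (b : Fin 4) :
    coeff 0 (rename (anfBlock Δ b) (anf K Δ)) = 0 := by
  rw [← constantCoeff_eq, constantCoeff_rename, constantCoeff_eq, coeff_zero_anf]

end Vars

/-! ### Monomials of `ANF_{Δ+1}` blockwise -/

section Support

variable {K : Type*} [Field K]

/-- The two block products of `ANF_{Δ+1}` have disjoint monomial sets.
[cite: MediniShpilka2021, proof of Lemma 5.12 ("`mon(g₁g₂), mon(g₃g₄) ⊆ mon(ANF)`", arXiv p0028:L9-L12)] -/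
theorem disjoint_support_blockProd (Δ : ℕ) (b : Fin 4) :
    Disjoint (rename (anfBlock Δ b) (anf K Δ) * rename (anfBlock Δ (1 - b)) (anf K Δ)).support
      (rename (anfBlock Δ (b + 2)) (anf K Δ) * rename (anfBlock Δ (1 - (b + 2))) (anf K Δ)).support := by
  classical
  obtain ⟨h1, h2, h3, h4⟩ := add_two_ne_self_aux b
  refine disjoint_support_of_disjoint_vars ?_ ?_
  · refine Finset.disjoint_of_subset_left (vars_mul _ _)
      (Finset.disjoint_of_subset_right (vars_mul _ _) ?_)
    rw [Finset.disjoint_union_left, Finset.disjoint_union_right, Finset.disjoint_union_right]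
    exact ⟨⟨disjoint_vars_rename_anfBlock Δ h1.symm _ _, disjoint_vars_rename_anfBlock Δ h3.symm _ _⟩,
      disjoint_vars_rename_anfBlock Δ h2.symm _ _, disjoint_vars_rename_anfBlock Δ h4.symm _ _⟩
  · rw [← constantCoeff_eq, map_mul, constantCoeff_eq, coeff_zero_rename_anfBlock_anf, zero_mul]
where
  /-- the far blocks are other blocks (local copy). [folklore] -/
  add_two_ne_self_aux (b : Fin 4) :
      b + 2 ≠ b ∧ b + 2 ≠ 1 - b ∧ 1 - (b + 2) ≠ b ∧ 1 - (b + 2) ≠ 1 - b := by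
    revert b; decide

/-- **`mon(ANF_{Δ+1}) = mon(A_b A_{1-b}) ⊔ mon(A_{b+2} A_{1-(b+2)})`.**
[cite: MediniShpilka2021, proof of Lemma 5.12 (arXiv p0028:L9-L12) with Def 8] -/
theorem support_anf_succ (Δ : ℕ) (b : Fin 4) :
    (anf K (Δ + 1)).support =
      (rename (anfBlock Δ b) (anf K Δ) * rename (anfBlock Δ (1 - b)) (anf K Δ)).support ∪
        (rename (anfBlock Δ (b + 2)) (anf K Δ) * rename (anfBlock Δ (1 - (b + 2))) (anf K Δ)).support := by
  classical
  rw [anf_succ_eq_block K Δ b]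
  exact Finsupp.support_add_eq (disjoint_support_blockProd Δ b)

/-- **Monomials of a product of two different renamed blocks** are the sums `m₁^{(b)} + m₂^{(b')}` of
renamed monomials of the factors. [cite: MediniShpilka2021, proof of Lemma 5.12 (arXiv p0028:L10-L36)] -/
theorem mem_support_rename_anfBlock_mul_iff (Δ : ℕ) {b b' : Fin 4} (hb : b ≠ b')
    (p q : MvPolynomial (Fin (4 ^ Δ)) K) {m : Fin (4 ^ (Δ + 1)) →₀ ℕ} :
    m ∈ (rename (anfBlock Δ b) p * rename (anfBlock Δ b') q).support ↔
      ∃ m₁ ∈ p.support, ∃ m₂ ∈ q.support,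
        m = m₁.mapDomain (anfBlock Δ b) + m₂.mapDomain (anfBlock Δ b') := by
  classical
  rw [mem_support_mul_iff_of_disjoint_vars (disjoint_vars_rename_anfBlock Δ hb p q),
    support_rename_of_injective (anfBlock_injective Δ b),
    support_rename_of_injective (anfBlock_injective Δ b')]
  constructor
  · rintro ⟨m₁, h₁, m₂, h₂, rfl⟩
    obtain ⟨n₁, hn₁, rfl⟩ := Finset.mem_image.mp h₁
    obtain ⟨n₂, hn₂, rfl⟩ := Finset.mem_image.mp h₂
    exact ⟨n₁, hn₁, n₂, hn₂, rfl⟩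
  · rintro ⟨m₁, h₁, m₂, h₂, rfl⟩
    exact ⟨_, Finset.mem_image_of_mem _ h₁, _, Finset.mem_image_of_mem _ h₂, rfl⟩

/-- Coefficients of a product of two different renamed blocks at a sum of renamed monomials.
[cite: MediniShpilka2021, proof of Lemma 5.12 (arXiv p0028:L10-L36)] -/
theorem coeff_rename_anfBlock_mul (Δ : ℕ) {b b' : Fin 4} (hb : b ≠ b')
    (p q : MvPolynomial (Fin (4 ^ Δ)) K) {m₁ m₂ : Fin (4 ^ Δ) →₀ ℕ} (h₁ : m₁ ∈ p.support)
    (h₂ : m₂ ∈ q.support) :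
    coeff (m₁.mapDomain (anfBlock Δ b) + m₂.mapDomain (anfBlock Δ b'))
        (rename (anfBlock Δ b) p * rename (anfBlock Δ b') q) = coeff m₁ p * coeff m₂ q := by
  classical
  rw [coeff_add_mul_of_disjoint_vars (disjoint_vars_rename_anfBlock Δ hb p q),
    coeff_rename_mapDomain _ (anfBlock_injective Δ b), coeff_rename_mapDomain _ (anfBlock_injective Δ b')]
  · rw [support_rename_of_injective (anfBlock_injective Δ b)]
    exact Finset.mem_image_of_mem _ h₁
  · rw [support_rename_of_injective (anfBlock_injective Δ b')]
    exact Finset.mem_image_of_mem _ h₂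

/-- The exponent of a renamed monomial lives in its block. [cite: MediniShpilka2021, Def 8] -/
theorem support_mapDomain_anfBlock_subset (Δ : ℕ) (b : Fin 4) (m : Fin (4 ^ Δ) →₀ ℕ) :
    (m.mapDomain (anfBlock Δ b)).support ⊆ Finset.univ.image (anfBlock Δ b) := by
  classical
  exact Finsupp.mapDomain_support.trans (Finset.image_subset_image (Finset.subset_univ _))

/-- **Uniqueness of the blockwise decomposition** of an exponent (`b ≠ b'`).
[cite: MediniShpilka2021, proof of Lemma 5.12 (arXiv p0028:L34-L36)] -/
theorem mapDomain_anfBlock_add_eq_add_iff (Δ : ℕ) {b b' : Fin 4} (hb : b ≠ b')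
    (m₁ m₂ n₁ n₂ : Fin (4 ^ Δ) →₀ ℕ) :
    m₁.mapDomain (anfBlock Δ b) + m₂.mapDomain (anfBlock Δ b') =
        n₁.mapDomain (anfBlock Δ b) + n₂.mapDomain (anfBlock Δ b') ↔ m₁ = n₁ ∧ m₂ = n₂ := by
  classical
  have hV : Disjoint (Finset.univ.image (anfBlock Δ b)) (Finset.univ.image (anfBlock Δ b')) := by
    rw [Finset.disjoint_left]
    intro x hx hx'
    obtain ⟨y, -, rfl⟩ := Finset.mem_image.mp hx
    obtain ⟨y', -, h⟩ := Finset.mem_image.mp hx'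
    exact hb (anfBlock_inj h).1.symm
  rw [add_eq_add_iff_of_support_subset_disjoint hV (support_mapDomain_anfBlock_subset Δ b m₁)
    (support_mapDomain_anfBlock_subset Δ b' m₂) (support_mapDomain_anfBlock_subset Δ b n₁)
    (support_mapDomain_anfBlock_subset Δ b' n₂)]
  exact ⟨fun h => ⟨Finsupp.mapDomain_injective (anfBlock_injective Δ b) h.1,
    Finsupp.mapDomain_injective (anfBlock_injective Δ b') h.2⟩, fun h => by rw [h.1, h.2]; exact ⟨rfl, rfl⟩⟩

end Support

/-! ### Siblings in the monomials of `ANF_{Δ+1}` -/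

section Sibling

variable {K : Type*} [Field K]

/-- **Siblings travel together**: for every variable `x_i` of `ANF_{Δ+1}` there is a sibling `x_{i'} ≠ x_i`
such that a monomial of `ANF_{Δ+1}` contains `x_i` iff it contains `x_{i'}`; consequently every monomial
of `∂ANF_{Δ+1}/∂x_i` (and of `∂g/∂x_i` for any `g` with `mon(g) ⊆ mon(ANF_{Δ+1})`) is divisible by
`x_{i'}`. With the decomposition `ANF = x_i x_{i'} P + R` of x5's `exists_sibling_decomposition`.
[cite: MediniShpilka2021, Obs 5.7-5.8 and proof of Lemma 5.12 ("every monomial of `∂g/∂x_i` is divisible by `x_j`", arXiv p0028:L7-L9)] -/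
theorem exists_sibling_mem_support (Δ : ℕ) (i : Fin (4 ^ (Δ + 1))) :
    ∃ i' : Fin (4 ^ (Δ + 1)), i' ≠ i ∧ ∃ P R : MvPolynomial (Fin (4 ^ (Δ + 1))) K,
      anf K (Δ + 1) = X i * X i' * P + R ∧ P ≠ 0 ∧
        i ∉ P.vars ∧ i' ∉ P.vars ∧ i ∉ R.vars ∧ i' ∉ R.vars ∧
        (∀ m ∈ (anf K (Δ + 1)).support, m i ≠ 0 → m i' ≠ 0) ∧
        (∀ m ∈ (anf K (Δ + 1)).support, m i' ≠ 0 → m i ≠ 0) := by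
  classical
  obtain ⟨i', hi', P, R, hdec, hP, hiP, hi'P, hiR, hi'R⟩ := exists_sibling_decomposition K Δ i
  -- monomials of `x_i x_{i'} P` contain both; monomials of `R` contain neither
  have hXXP : ∀ m ∈ (X i * X i' * P : MvPolynomial (Fin (4 ^ (Δ + 1))) K).support,
      m i ≠ 0 ∧ m i' ≠ 0 := by
    intro m hm
    rw [mul_assoc, support_X_mul, Finset.mem_map] at hm
    obtain ⟨m', hm', rfl⟩ := hm
    rw [support_X_mul, Finset.mem_map] at hm'
    obtain ⟨m'', -, rfl⟩ := hm'
    simp only [addLeftEmbedding_apply, Finsupp.add_apply, Finsupp.single_eq_same,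
      Finsupp.single_eq_of_ne hi', Finsupp.single_eq_of_ne hi'.symm]
    omega
  have hRi : ∀ m ∈ R.support, m i = 0 := fun m hm =>
    Finsupp.notMem_support_iff.mp fun h => hiR ((mem_vars_iff_mem_support i).mpr ⟨m, hm, h⟩)
  have hRi' : ∀ m ∈ R.support, m i' = 0 := fun m hm =>
    Finsupp.notMem_support_iff.mp fun h => hi'R ((mem_vars_iff_mem_support i').mpr ⟨m, hm, h⟩)
  have key : ∀ m ∈ (anf K (Δ + 1)).support, (m i ≠ 0 ∨ m i' ≠ 0) →
      m ∈ (X i * X i' * P : MvPolynomial (Fin (4 ^ (Δ + 1))) K).support := by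
    intro m hm h
    rw [hdec] at hm
    rcases Finset.mem_union.mp (support_add hm) with h1 | h1
    · exact h1
    · rcases h with h | h
      · exact absurd (hRi m h1) h
      · exact absurd (hRi' m h1) h
  refine ⟨i', hi', P, R, hdec, hP, hiP, hi'P, hiR, hi'R, fun m hm h => (hXXP m (key m hm (Or.inl h))).2,
    fun m hm h => (hXXP m (key m hm (Or.inr h))).1⟩

end Sibling

/-! ### Block permutations (the `TR` symmetries used "WLOG" in the proof of Lemma 5.12) -/

section BlockPerm

variable {K : Type*} [Field K]

/-- **A block permutation exists**: for a permutation `τ` of the four blocks and permutations `π_b`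
inside the blocks there is a permutation `P` of the variables of `ANF_{Δ+1}` with
`P(x^{(b)}_j) = x^{(τ b)}_{π_b j}`. [cite: MediniShpilka2021, Def 8 and Cor 5.4 (`TR` acts blockwise; arXiv p0025:L31-L37)] -/
theorem exists_perm_anfBlock (Δ : ℕ) (τ : Equiv.Perm (Fin 4)) (π : Fin 4 → Equiv.Perm (Fin (4 ^ Δ))) :
    ∃ P : Equiv.Perm (Fin (4 ^ (Δ + 1))), ∀ b j, P (anfBlock Δ b j) = anfBlock Δ (τ b) (π b j) := by
  let e : Fin 4 × Fin (4 ^ Δ) ≃ Fin (4 ^ (Δ + 1)) :=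
    finProdFinEquiv.trans (finCongr (pow_succ' 4 Δ).symm)
  have he : ∀ p : Fin 4 × Fin (4 ^ Δ), e p = anfBlock Δ p.1 p.2 := fun p => rfl
  set T : Equiv.Perm (Fin 4 × Fin (4 ^ Δ)) :=
    (Equiv.prodCongrRight π).trans (Equiv.prodCongr τ (Equiv.refl _)) with hT
  refine ⟨e.symm.trans (T.trans e), fun b j => ?_⟩
  have h1 : e.symm (anfBlock Δ b j) = (b, j) := by
    rw [← he (b, j), Equiv.symm_apply_apply]
  show e (T (e.symm (anfBlock Δ b j))) = _
  rw [h1]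
  exact he (τ b, π b j)

/-- The far blocks, decidably. [folklore] -/
private theorem eq_add_two_or_of_ne {c d : Fin 4} (h₁ : d ≠ c) (h₂ : d ≠ 1 - c) :
    d = c + 2 ∨ d = 1 - (c + 2) := by
  revert c d; decide

/-- **`ANF_{Δ+1}` is invariant under pairing-preserving block permutations with `ANF_Δ`-symmetries
inside the blocks**: if `τ(1-b) = 1-τ(b)` for all `b` and `rename π_b ANF_Δ = ANF_Δ`, then every `P`
with `P(x^{(b)}_j) = x^{(τ b)}_{π_b j}` fixes `ANF_{Δ+1}`. (The `TR_{4^Δ}` symmetries entering "every time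
we use WLOG" in the proof of Lemma 5.12.) [cite: MediniShpilka2021, Cor 5.4 and proof of Lemma 5.12 (last paragraph, arXiv p0028:L38-L40)] -/
theorem rename_anf_succ_eq_of_blockPerm (Δ : ℕ) {τ : Equiv.Perm (Fin 4)}
    (hτ : ∀ b, τ (1 - b) = 1 - τ b) {π : Fin 4 → Equiv.Perm (Fin (4 ^ Δ))}
    (hπ : ∀ b, rename (π b) (anf K Δ) = anf K Δ) {P : Equiv.Perm (Fin (4 ^ (Δ + 1)))}
    (hP : ∀ b j, P (anfBlock Δ b j) = anfBlock Δ (τ b) (π b j)) :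
    rename P (anf K (Δ + 1)) = anf K (Δ + 1) := by
  have hA : ∀ b, rename P (rename (anfBlock Δ b) (anf K Δ)) = rename (anfBlock Δ (τ b)) (anf K Δ) := by
    intro b
    have hcomp : (P : Fin (4 ^ (Δ + 1)) → Fin (4 ^ (Δ + 1))) ∘ anfBlock Δ b = anfBlock Δ (τ b) ∘ π b :=
      funext fun j => hP b j
    rw [rename_rename, hcomp, ← rename_rename, hπ]
  have h10 : τ 1 = 1 - τ 0 := by rw [← hτ 0]; rfl
  have h32 : τ 3 = 1 - τ 2 := by rw [← hτ 2]; rfl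
  have hne1 : τ 2 ≠ τ 0 := fun h => by simpa using τ.injective h
  have hne2 : τ 2 ≠ 1 - τ 0 := fun h => by rw [← h10] at h; simpa using τ.injective h
  conv_lhs => rw [anf_succ, map_add, map_mul, map_mul, hA, hA, hA, hA, h10, h32]
  rw [anf_succ_eq_block K Δ (τ 0)]
  rcases eq_add_two_or_of_ne hne1 hne2 with h | h
  · rw [h]
  · rw [h, sub_sub_cancel, mul_comm (rename (anfBlock Δ (1 - (τ 0 + 2))) (anf K Δ))]

/-- **Blockwise evaluation of a scaled permutation substitution**: with `P(x^{(b)}_j) = x^{(τ b)}_{π_b j}`,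
`(A_b)(α_i x_{P i}) = (ANF_Δ(α^{(b)}_j x_{π_b j}))^{(τ b)}` — the assembly of `α, π` blockwise in the
induction of Lemma 5.12. [cite: MediniShpilka2021, proof of Lemma 5.12 (last paragraph, arXiv p0028:L38-L40)] -/
theorem aeval_C_mul_X_perm_rename_anfBlock (Δ : ℕ) (α : Fin (4 ^ (Δ + 1)) → K)
    {τ : Equiv.Perm (Fin 4)} {π : Fin 4 → Equiv.Perm (Fin (4 ^ Δ))}
    {P : Equiv.Perm (Fin (4 ^ (Δ + 1)))} (hP : ∀ b j, P (anfBlock Δ b j) = anfBlock Δ (τ b) (π b j))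
    (b : Fin 4) (p : MvPolynomial (Fin (4 ^ Δ)) K) :
    aeval (fun i => C (α i) * X (P i)) (rename (anfBlock Δ b) p) =
      rename (anfBlock Δ (τ b)) (aeval (fun j => C (α (anfBlock Δ b j)) * X (π b j)) p) := by
  rw [aeval_rename, ← AlgHom.comp_apply]
  congr 1
  refine MvPolynomial.algHom_ext fun j => ?_
  rw [AlgHom.comp_apply, aeval_X, aeval_X, Function.comp_apply, map_mul, rename_C, rename_X, hP]

end BlockPerm

end MS2021

end Literature.Computability.AlgebraicComplexity

end
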